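import Summits.CriticalPhenomena.PercolationContinuityZ3.Theorems.PercNearOneGluingNoHeavyLowerTailNineTypePureCount

/-!
# Nine-type programme for `Q44b`: the CUBE certificate — K1 for every circuit whose non-anchors avoid types 1, 2

Support file for crux `stmt-CriticalPhenomena-4575` (`Q44b`, GF(2)-rank line of `prim-bnk-1`), seat `prim-bnk-1` gen 19;
memo `run/shared/lean/prim/prim-l12/FROM-prim-bnk-1-gen19-HALL-GRAM-ASSEMBLY.md` §13.

For an H-dependency `Z ⊔ A` (`A` = anchors, types 8/9; `Z` = the other members, here of types 3–7) the CUBE DETECTOR is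
`δ(u) = #{(z,a) ∈ Z × A : z ∪ a ∈ 𝔊, z ∪ a ⊆ u} (mod 2)` — the sum of the full cubes `↑(z ∪ a)` over the GOOD cross pairs
(for a pure dependency every cross pair is HH-good and `δ` is the half-sum of `…NineTypePHO`).  Two table facts make the
bad cross pairs harmless: a cross pair with `z ∪ a ∉ 𝔊` is covered by no point (`z ∪ a ∪ s ≠ univ`, else
`z ∪ a ⊇ s ∪ zᶜ` or `a ∪ sᶜ` would be HL-good) and contains no free point `r` (`z ∪ a ⊇ r ∪ a` would be HH-good).  Hence:
* `cover_parity_core'` — the symmetric double count of `…NineTypePHO`, with the diagonal kept;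
* `cube_detector_orthogonal` — `δ ⊥ v_s` for every `s ∈ 𝒯`;
* `cube_detector_corow` — `⟨δ, w_r⟩ = [r ∈ Z]` for every free `r ∈ 𝒯` not strictly inside a member of `Z`;
* `detector_certificate` — a detector orthogonal to the rows of `S` and the co-rows of `Rc` and pairing to `1` with the
  co-row of `t` forbids `S ⊔ Rc` from representing the L-row of `t`.
Pure finite combinatorics; no named facts, no sorries, standard axioms.
-/

namespace Summit.CriticalPhenomena.PercolationContinuityZ3.Theorems

namespace NineType

open Finset

variable {α : Type*} [DecidableEq α] [Fintype α]

/-- **Core double count, diagonal kept.**  Families `P, Q`, a set `c`, an up-set `𝔊` with the flipped dependency between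
`P` and `Q`; whenever a pair `(p,q)` or `(q',q)` covers `univ` together with `c`, the set `c ∪ q` is good.  Then
`#{(p,q) : p ∪ q ∪ c = univ} ≡ #{q ∈ Q : q ∪ c = univ}` (mod 2). [this work] -/
theorem cover_parity_core' (𝔊 : Finset (Finset α))
    (P Q : Finset (Finset α)) (c : Finset α)
    (hflip : ∀ g ∈ 𝔊, ((#(P.filter (fun p => pᶜ ⊆ g)) : ℕ) : ZMod 2) = ((#(Q.filter (fun q => qᶜ ⊆ g)) : ℕ) : ZMod 2))
    (hPQ : ∀ q ∈ Q, ∀ p ∈ P, p ∪ q ∪ c = univ → c ∪ q ∈ 𝔊)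
    (hQQ : ∀ q ∈ Q, ∀ q' ∈ Q, q' ∪ q ∪ c = univ → c ∪ q ∈ 𝔊) :
    (∑ p ∈ P, ∑ q ∈ Q, (if p ∪ q ∪ c = univ then (1 : ZMod 2) else 0))
      = ((#(Q.filter (fun q => q ∪ c = univ)) : ℕ) : ZMod 2) := by
  rw [Finset.sum_comm]
  have hinner : ∀ q ∈ Q, (∑ p ∈ P, (if p ∪ q ∪ c = univ then (1 : ZMod 2) else 0))
      = ∑ q' ∈ Q, (if q' ∪ q ∪ c = univ then (1 : ZMod 2) else 0) := by
    intro q hq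
    by_cases hgood : c ∪ q ∈ 𝔊
    · have hf := hflip (c ∪ q) hgood
      rw [card_filter_cast, card_filter_cast] at hf
      have hl : (∑ p ∈ P, (if p ∪ q ∪ c = univ then (1 : ZMod 2) else 0))
          = ∑ p ∈ P, (if pᶜ ⊆ c ∪ q then (1 : ZMod 2) else 0) := by
        refine Finset.sum_congr rfl fun p _ => ?_
        by_cases h : p ∪ q ∪ c = univ
        · rw [if_pos h, if_pos ((union3_eq_univ_iff p q c).1 h)]
        · rw [if_neg h, if_neg (fun h' => h ((union3_eq_univ_iff p q c).2 h'))]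
      have hr : (∑ q' ∈ Q, (if q' ∪ q ∪ c = univ then (1 : ZMod 2) else 0))
          = ∑ q' ∈ Q, (if q'ᶜ ⊆ c ∪ q then (1 : ZMod 2) else 0) := by
        refine Finset.sum_congr rfl fun q' _ => ?_
        by_cases h : q' ∪ q ∪ c = univ
        · rw [if_pos h, if_pos ((union3_eq_univ_iff q' q c).1 h)]
        · rw [if_neg h, if_neg (fun h' => h ((union3_eq_univ_iff q' q c).2 h'))]
      rw [hl, hr]; exact hf
    · have hl : (∑ p ∈ P, (if p ∪ q ∪ c = univ then (1 : ZMod 2) else 0)) = 0 :=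
        Finset.sum_eq_zero fun p hp => if_neg (fun hcov => hgood (hPQ q hq p hp hcov))
      have hr : (∑ q' ∈ Q, (if q' ∪ q ∪ c = univ then (1 : ZMod 2) else 0)) = 0 :=
        Finset.sum_eq_zero fun q' hq' => if_neg (fun hcov => hgood (hQQ q hq q' hq' hcov))
      rw [hl, hr]
  rw [Finset.sum_congr rfl hinner]
  have hsym := sum_card_filter_symm Q (fun q' q => q' ∪ q ∪ c = univ) (by
    intro b _ b' _ h
    rw [← h]; ext x; simp only [Finset.mem_union]; tauto)
  have hrw : (∑ q ∈ Q, ∑ q' ∈ Q, (if q' ∪ q ∪ c = univ then (1 : ZMod 2) else 0))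
      = ∑ q ∈ Q, ((#(Q.filter (fun q' => q' ∪ q ∪ c = univ)) : ℕ) : ZMod 2) := by
    refine Finset.sum_congr rfl fun q _ => ?_
    rw [card_filter_cast]
  rw [hrw, hsym]
  congr 2
  ext q
  simp only [Finset.mem_filter, Finset.union_idempotent]

/-! ## The cube detector -/

/-- The cube detector of a cross family `Z × A` over the goods `𝔊`, as a function on sets:
`δ(u) = #{(z,a) : z ∪ a ∈ 𝔊, z ∪ a ⊆ u} (mod 2)`, written as a double sum of indicators. -/
theorem cube_sum_superset (𝔊 : Finset (Finset α))
    (hG : ∀ g ∈ 𝔊, ∀ g' : Finset α, g ⊆ g' → g' ∈ 𝔊)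
    (Z A : Finset (Finset α)) (c : Finset α) :
    (∑ u ∈ 𝔊.filter (fun u => c ⊆ u), ∑ z ∈ Z, ∑ a ∈ A,
        (if z ∪ a ∈ 𝔊 ∧ z ∪ a ⊆ u then (1 : ZMod 2) else 0))
      = ∑ z ∈ Z, ∑ a ∈ A, (if z ∪ a ∈ 𝔊 ∧ z ∪ a ∪ c = univ then (1 : ZMod 2) else 0) := by
  rw [Finset.sum_comm]
  refine Finset.sum_congr rfl fun z _ => ?_
  rw [Finset.sum_comm]
  refine Finset.sum_congr rfl fun a _ => ?_
  by_cases hza : z ∪ a ∈ 𝔊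
  · rw [Finset.sum_filter]
    have hstep : (∑ u ∈ 𝔊, (if c ⊆ u then (if z ∪ a ∈ 𝔊 ∧ z ∪ a ⊆ u then (1 : ZMod 2) else 0) else 0))
        = ∑ u ∈ 𝔊, (if z ∪ a ∪ c ⊆ u then (1 : ZMod 2) else 0) := by
      refine Finset.sum_congr rfl fun u _ => ?_
      by_cases hcu : c ⊆ u
      · by_cases hzu : z ∪ a ⊆ u
        · rw [if_pos hcu, if_pos ⟨hza, hzu⟩, if_pos (Finset.union_subset hzu hcu)]
        · rw [if_pos hcu, if_neg (fun h => hzu h.2), if_neg (fun h => hzu (subset_union_left.trans h))]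
      · rw [if_neg hcu, if_neg (fun h => hcu (subset_union_right.trans h))]
    rw [hstep, ← card_filter_cast, card_supersets_parity 𝔊 hG (z ∪ a ∪ c) (hG _ hza _ subset_union_left)]
    by_cases hu : z ∪ a ∪ c = univ
    · rw [if_pos hu, if_pos ⟨hza, hu⟩]
    · rw [if_neg hu, if_neg (fun h => hu h.2)]
  · rw [if_neg (fun h => hza h.1)]
    exact Finset.sum_eq_zero fun u _ => if_neg (fun h => hza h.1)

/-- Table fact: `hlOK x z` for every type `x` and `z ∈ {3,4,6}`, and for `x ≤ 7`, `z ∈ {5,7}`. -/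
theorem hlOK_mid (x z : ℕ) (hx : 1 ≤ x ∧ x ≤ 9) (hz : z = 3 ∨ z = 4 ∨ z = 5 ∨ z = 6 ∨ z = 7)
    (h : x ≤ 7 ∨ (z = 3 ∨ z = 4 ∨ z = 6)) : hlOK x z = true := by
  rcases hx with ⟨h1, h9⟩
  interval_cases x <;> rcases hz with rfl | rfl | rfl | rfl | rfl <;> simp_all (config := {decide := true})

/-- Table fact: types in `{3,…,7}` are pairwise HL-compatible. -/
theorem hlOK_mid_mid (x z : ℕ) (hx : x = 3 ∨ x = 4 ∨ x = 5 ∨ x = 6 ∨ x = 7)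
    (hz : z = 3 ∨ z = 4 ∨ z = 5 ∨ z = 6 ∨ z = 7) : hlOK x z = true := by
  rcases hx with rfl | rfl | rfl | rfl | rfl <;> rcases hz with rfl | rfl | rfl | rfl | rfl <;> decide

/-- **Bad cross pairs are covered by no point.**  If `z` (type ≤ 7) and `a` (type 8/9) are points with `z ∪ a ∉ 𝔊`,
then `z ∪ a ∪ s ≠ univ` for every point `s`. [this work] -/
theorem bad_pair_not_covered (𝒯 : Finset (Finset α)) (θ : Finset α → ℕ)
    (hθ : ∀ s ∈ 𝒯, 1 ≤ θ s ∧ θ s ≤ 9)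
    (𝔊 : Finset (Finset α)) (hG : ∀ g ∈ 𝔊, ∀ g' : Finset α, g ⊆ g' → g' ∈ 𝔊)
    (hHL : ∀ s ∈ 𝒯, ∀ s' ∈ 𝒯, hlOK (θ s) (θ s') = true → s ∪ s'ᶜ ∈ 𝔊)
    (z : Finset α) (hz : z ∈ 𝒯) (hzt : θ z ≤ 7) (a : Finset α) (ha : a ∈ 𝒯) (hat : θ a = 8 ∨ θ a = 9)
    (hbad : z ∪ a ∉ 𝔊) (s : Finset α) (hs : s ∈ 𝒯) : z ∪ a ∪ s ≠ univ := by
  intro hcov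
  have hsc : sᶜ ⊆ z ∪ a := (union_eq_univ_iff_compl_subset (z ∪ a) s).1 hcov
  have hθs := hθ s hs
  by_cases h57 : θ s = 5 ∨ θ s = 7
  · -- z ∪ sᶜ is HL-good
    have hok : hlOK (θ z) (θ s) = true := by
      have hθz := hθ z hz
      rcases hθz with ⟨h1, _⟩
      have : θ z = 1 ∨ θ z = 2 ∨ θ z = 3 ∨ θ z = 4 ∨ θ z = 5 ∨ θ z = 6 ∨ θ z = 7 := by omega
      rcases this with h | h | h | h | h | h | h <;> rcases h57 with h' | h' <;> rw [h, h'] <;> decide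
    exact hbad (hG _ (hHL z hz s hs hok) _ (Finset.union_subset subset_union_left hsc))
  · -- a ∪ sᶜ is HL-good
    have hok : hlOK (θ a) (θ s) = true := by
      rcases hθs with ⟨h1, h9⟩
      have : θ s = 1 ∨ θ s = 2 ∨ θ s = 3 ∨ θ s = 4 ∨ θ s = 6 ∨ θ s = 8 ∨ θ s = 9 := by omega
      rcases hat with h | h <;> rcases this with h' | h' | h' | h' | h' | h' | h' <;> rw [h, h'] <;> decide
    exact hbad (hG _ (hHL a ha s hs hok) _ (Finset.union_subset subset_union_right hsc))

/-- **Cube detector: orthogonality to every H-row.**  `Z ⊔ A` an H-dependency with `Z`-types in `{3,…,7}` and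
`A`-types in `{8,9}`; then for every point `s`, `#{(z,a) ∈ Z × A : z ∪ a ∈ 𝔊, z ∪ a ∪ s = univ}` is even. [this work] -/
theorem cube_detector_orthogonal (𝒯 : Finset (Finset α)) (θ : Finset α → ℕ)
    (hθ : ∀ s ∈ 𝒯, 1 ≤ θ s ∧ θ s ≤ 9)
    (hcov : ∀ s ∈ 𝒯, ∀ s' ∈ 𝒯, s ≠ s' → s ∪ s' ≠ univ)
    (𝔊 : Finset (Finset α)) (hG : ∀ g ∈ 𝔊, ∀ g' : Finset α, g ⊆ g' → g' ∈ 𝔊)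
    (hHL : ∀ s ∈ 𝒯, ∀ s' ∈ 𝒯, hlOK (θ s) (θ s') = true → s ∪ s'ᶜ ∈ 𝔊)
    (Z A : Finset (Finset α)) (hZ : Z ⊆ 𝒯) (hA : A ⊆ 𝒯)
    (hZt : ∀ z ∈ Z, θ z = 3 ∨ θ z = 4 ∨ θ z = 5 ∨ θ z = 6 ∨ θ z = 7) (hAt : ∀ a ∈ A, θ a = 8 ∨ θ a = 9)
    (hdep : ∀ g ∈ 𝔊, ((#(Z.filter (fun y => y ⊆ g)) : ℕ) : ZMod 2) = ((#(A.filter (fun a => a ⊆ g)) : ℕ) : ZMod 2)) :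
    ∀ s ∈ 𝒯, (∑ z ∈ Z, ∑ a ∈ A, (if z ∪ a ∈ 𝔊 ∧ z ∪ a ∪ s = univ then (1 : ZMod 2) else 0)) = 0 := by
  intro s hs
  have hZA : Disjoint Z A := by
    rw [Finset.disjoint_left]; intro x hxZ hxA
    rcases hZt x hxZ with h | h | h | h | h <;> rcases hAt x hxA with h' | h' <;> omega
  -- drop the goodness condition: bad pairs are never covering
  have hdrop : (∑ z ∈ Z, ∑ a ∈ A, (if z ∪ a ∈ 𝔊 ∧ z ∪ a ∪ s = univ then (1 : ZMod 2) else 0))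
      = ∑ z ∈ Z, ∑ a ∈ A, (if z ∪ a ∪ s = univ then (1 : ZMod 2) else 0) := by
    refine Finset.sum_congr rfl fun z hz => Finset.sum_congr rfl fun a ha => ?_
    by_cases hza : z ∪ a ∈ 𝔊
    · by_cases hu : z ∪ a ∪ s = univ
      · rw [if_pos ⟨hza, hu⟩, if_pos hu]
      · rw [if_neg (fun h => hu h.2), if_neg hu]
    · have hzt : θ z ≤ 7 := by rcases hZt z hz with h | h | h | h | h <;> omega
      rw [if_neg (fun h => hza h.1), if_neg (bad_pair_not_covered 𝒯 θ hθ 𝔊 hG hHL z (hZ hz) hzt a (hA ha)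
        (hAt a ha) hza s hs)]
  rw [hdrop]
  -- flipped dependency
  have hdep0 : ∀ g ∈ 𝔊, ((#((Z ∪ A).filter (fun ρ => ρ ⊆ g)) : ℕ) : ZMod 2) = 0 := by
    intro g hg; rw [card_filter_union_cast Z A hZA, hdep g hg]; exact CharTwo.add_self_eq_zero _
  have hflip : ∀ g ∈ 𝔊, ((#(Z.filter (fun y => yᶜ ⊆ g)) : ℕ) : ZMod 2)
      = ((#(A.filter (fun a => aᶜ ⊆ g)) : ℕ) : ZMod 2) := by
    intro g hg
    have h0 := flip_even 𝔊 hG (Z ∪ A) hdep0 g hg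
    rw [card_filter_union_cast Z A hZA] at h0
    have heq : ∀ x y : ZMod 2, x + y = 0 → x = y := by
      intro x y h; fin_cases x <;> fin_cases y <;> first | rfl | exact absurd h (by decide)
    exact heq _ _ h0
  have hθs := hθ s hs
  by_cases hlow : θ s ≤ 7
  · -- orientation (P,Q) = (Z,A): a covering pair makes s ∪ a good via s ∪ zᶜ (or a ∪ a'ᶜ)
    rw [cover_parity_core' 𝔊 Z A s hflip ?_ ?_]
    · have hempty : A.filter (fun a => a ∪ s = univ) = ∅ :=
        Finset.filter_eq_empty_iff.2 fun a ha h => hcov a (hA ha) s hs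
          (fun has => by rcases hAt a ha with h8 | h9 <;> rw [has] at * <;> omega) h
      rw [hempty, Finset.card_empty, Nat.cast_zero]
    · intro a ha z hz hcover
      have hok : hlOK (θ s) (θ z) = true := hlOK_mid _ _ hθs (hZt z hz) (Or.inl hlow)
      exact hG _ (hHL s hs z (hZ hz) hok) _
        (Finset.union_subset subset_union_left ((union3_eq_univ_iff z a s).1 hcover))
    · intro a ha a' ha' hcover
      exact hG _ (hHL a (hA ha) a' (hA ha') (hlOK_anchor _ _ (hAt a ha) (hAt a' ha'))) _
        (Finset.union_subset subset_union_right ((union3_eq_univ_iff a' a s).1 hcover))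
  · -- θ s ∈ {8,9}: orientation (P,Q) = (A,Z)
    have h89 : θ s = 8 ∨ θ s = 9 := by omega
    rw [Finset.sum_comm]
    have hswap : (∑ a ∈ A, ∑ z ∈ Z, (if z ∪ a ∪ s = univ then (1 : ZMod 2) else 0))
        = ∑ a ∈ A, ∑ z ∈ Z, (if a ∪ z ∪ s = univ then (1 : ZMod 2) else 0) := by
      refine Finset.sum_congr rfl fun a _ => Finset.sum_congr rfl fun z _ => ?_
      rw [Finset.union_comm z a]
    rw [hswap, cover_parity_core' 𝔊 A Z s (fun g hg => (hflip g hg).symm) ?_ ?_]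
    · have hempty : Z.filter (fun z => z ∪ s = univ) = ∅ :=
        Finset.filter_eq_empty_iff.2 fun z hz h => hcov z (hZ hz) s hs
          (fun hzs => by rcases hZt z hz with h' | h' | h' | h' | h' <;> rw [hzs] at * <;> omega) h
      rw [hempty, Finset.card_empty, Nat.cast_zero]
    · intro z hz a ha hcover
      exact hG _ (hHL s hs a (hA ha) (hlOK_anchor _ _ h89 (hAt a ha))) _
        (Finset.union_subset subset_union_left ((union3_eq_univ_iff a z s).1 hcover))
    · intro z hz z' hz' hcover
      exact hG _ (hHL z (hZ hz) z' (hZ hz') (hlOK_mid_mid _ _ (hZt z hz) (hZt z' hz'))) _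
        (Finset.union_subset subset_union_right ((union3_eq_univ_iff z' z s).1 hcover))

/-- **Cube detector against a free co-row.**  For a free point `r` (type 5/7) not strictly inside any member of `Z`,
`#{(z,a) ∈ Z × A : z ∪ a ∈ 𝔊, z ∪ a ∪ rᶜ = univ} ≡ [r ∈ Z]` (mod 2). [this work] -/
theorem cube_detector_corow (𝒯 : Finset (Finset α)) (θ : Finset α → ℕ)
    (𝔊 : Finset (Finset α)) (hG : ∀ g ∈ 𝔊, ∀ g' : Finset α, g ⊆ g' → g' ∈ 𝔊)
    (hHL : ∀ s ∈ 𝒯, ∀ s' ∈ 𝒯, hlOK (θ s) (θ s') = true → s ∪ s'ᶜ ∈ 𝔊)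
    (hHH : ∀ s ∈ 𝒯, ∀ s' ∈ 𝒯, s ≠ s' → hhOK (θ s) (θ s') = true → s ∪ s' ∈ 𝔊)
    (Z A : Finset (Finset α)) (hZ : Z ⊆ 𝒯) (hA : A ⊆ 𝒯)
    (hZt : ∀ z ∈ Z, θ z = 3 ∨ θ z = 4 ∨ θ z = 5 ∨ θ z = 6 ∨ θ z = 7) (hAt : ∀ a ∈ A, θ a = 8 ∨ θ a = 9)
    (hdep : ∀ g ∈ 𝔊, ((#(Z.filter (fun y => y ⊆ g)) : ℕ) : ZMod 2) = ((#(A.filter (fun a => a ⊆ g)) : ℕ) : ZMod 2))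
    (r : Finset α) (hr : r ∈ 𝒯) (hrt : θ r = 5 ∨ θ r = 7) (hmax : ∀ z ∈ Z, r ⊆ z → z = r) :
    (∑ z ∈ Z, ∑ a ∈ A, (if z ∪ a ∈ 𝔊 ∧ z ∪ a ∪ rᶜ = univ then (1 : ZMod 2) else 0))
      = if r ∈ Z then 1 else 0 := by
  have hZA : Disjoint Z A := by
    rw [Finset.disjoint_left]; intro x hxZ hxA
    rcases hZt x hxZ with h | h | h | h | h <;> rcases hAt x hxA with h' | h' <;> omega
  -- a cross pair covering rᶜ contains r ∪ a, which is HH-good: no bad pair covers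
  have hdrop : (∑ z ∈ Z, ∑ a ∈ A, (if z ∪ a ∈ 𝔊 ∧ z ∪ a ∪ rᶜ = univ then (1 : ZMod 2) else 0))
      = ∑ z ∈ Z, ∑ a ∈ A, (if z ∪ a ∪ rᶜ = univ then (1 : ZMod 2) else 0) := by
    refine Finset.sum_congr rfl fun z hz => Finset.sum_congr rfl fun a ha => ?_
    by_cases hu : z ∪ a ∪ rᶜ = univ
    · have hra : r ⊆ z ∪ a := by
        have := (union_eq_univ_iff_compl_subset (z ∪ a) rᶜ).1 hu; rwa [compl_compl] at this
      have hne : r ≠ a := by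
        intro h; rcases hrt with h5 | h7 <;> rcases hAt a ha with h8 | h9 <;> rw [h] at * <;> omega
      have hgood : z ∪ a ∈ 𝔊 := hG _ (hHH r hr a (hA ha) hne (hhOK_free_anchor _ _ hrt (hAt a ha))) _
        (Finset.union_subset hra subset_union_right)
      rw [if_pos ⟨hgood, hu⟩, if_pos hu]
    · rw [if_neg (fun h => hu h.2), if_neg hu]
  rw [hdrop]
  have hdep0 : ∀ g ∈ 𝔊, ((#((Z ∪ A).filter (fun ρ => ρ ⊆ g)) : ℕ) : ZMod 2) = 0 := by
    intro g hg; rw [card_filter_union_cast Z A hZA, hdep g hg]; exact CharTwo.add_self_eq_zero _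
  have hflip : ∀ g ∈ 𝔊, ((#(Z.filter (fun y => yᶜ ⊆ g)) : ℕ) : ZMod 2)
      = ((#(A.filter (fun a => aᶜ ⊆ g)) : ℕ) : ZMod 2) := by
    intro g hg
    have h0 := flip_even 𝔊 hG (Z ∪ A) hdep0 g hg
    rw [card_filter_union_cast Z A hZA] at h0
    have heq : ∀ x y : ZMod 2, x + y = 0 → x = y := by
      intro x y h; fin_cases x <;> fin_cases y <;> first | rfl | exact absurd h (by decide)
    exact heq _ _ h0
  -- orientation (P,Q) = (A,Z): rᶜ ∪ z is HL-good for every z ∈ Z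
  rw [Finset.sum_comm]
  have hswap : (∑ a ∈ A, ∑ z ∈ Z, (if z ∪ a ∪ rᶜ = univ then (1 : ZMod 2) else 0))
      = ∑ a ∈ A, ∑ z ∈ Z, (if a ∪ z ∪ rᶜ = univ then (1 : ZMod 2) else 0) := by
    refine Finset.sum_congr rfl fun a _ => Finset.sum_congr rfl fun z _ => ?_
    rw [Finset.union_comm z a]
  have hgoodz : ∀ z ∈ Z, rᶜ ∪ z ∈ 𝔊 := by
    intro z hz
    rw [Finset.union_comm]
    exact hHL z (hZ hz) r hr (by
      rcases hZt z hz with h | h | h | h | h <;> rcases hrt with h' | h' <;> rw [h, h'] <;> decide)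
  rw [hswap, cover_parity_core' 𝔊 A Z rᶜ (fun g hg => (hflip g hg).symm)
    (fun z hz _ _ _ => hgoodz z hz) (fun z hz _ _ _ => hgoodz z hz)]
  -- the diagonal: z ∪ rᶜ = univ ↔ r ⊆ z ↔ z = r
  have hfilt : Z.filter (fun z => z ∪ rᶜ = univ) = Z.filter (fun z => z = r) := by
    refine Finset.filter_congr fun z hz => ?_
    rw [union_eq_univ_iff_compl_subset z rᶜ, compl_compl]
    exact ⟨fun h => hmax z hz h, fun h => h ▸ subset_refl r⟩
  rw [hfilt]
  by_cases hrZ : r ∈ Z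
  · rw [if_pos hrZ, Finset.filter_eq' Z r, if_pos hrZ, Finset.card_singleton, Nat.cast_one]
  · rw [if_neg hrZ, Finset.filter_eq' Z r, if_neg hrZ, Finset.card_empty, Nat.cast_zero]

end NineType

end Summit.CriticalPhenomena.PercolationContinuityZ3.Theorems
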